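import Summits.BirchSwinnertonDyer.BirchSwinnertonDyer.Theorems.KimAtThreeFineKatoPrintClauses
import Summits.BirchSwinnertonDyer.BirchSwinnertonDyer.Theorems.KimAtThreeDeepUpperExpStarUnit
import HarnessLib

/-!
# `ZetaBody` (C3a)/(C3b) for a single-completion DEFINED value datum on EVERY `3`-adic-tower row — the
# STRATUM-FREE discharger (crux `DeepUpperAtThree` 19076 and the deep leaf 19075 / 19562 / 20013 / `N11.KimAtThreeDeepPUB`;
# route `KimAtThreeKolyvagin`, rung W2; cell `bsd-addord`, seat w2-c3 gen 9; `--supports 19076`, helper)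

HONEST FRAMING.  TOOL theorems only (no definition, no named fact used except the cite-only (S5b)
`PAdicHodge.exists_smul_range_expStarCoord_iff_trace_log` in `exists_expStarOmegaAt_ne_zero_of_facts`, taken as a
theorem binder; local instance attributes only inside the generic section, as in `KimAtThreeDeepUpperExpStarFacts`;
no `sorry`); the (DEF₀)/(RES₀) clauses and the Prop-1.2.3 binders are
DISPLAYED hypotheses exactly as in kim3's `KimAtThreeFineKatoPrintClauses.zetaBody_C3_of_level`; closes nothing;
nothing is booked; BSD is not proved by any of this.

WHY.  kim3 g15's `zetaBody_C3_of_level` (p518197) proves the two own-attribution clauses (C3a) `Λ(σ·y) = (1 ⊗ σ̃)Λ(y)`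
and (C3b) "`Λ` is local at `3`" of `Kato2004.ZetaBody` for a value datum `Λ_{k,r}` defined through ONE completion
(clauses (DEF₀)/(RES₀)), on a KATO-STRATUM row: its binders `Addv W 3`, `3 ∤ c₃`, `E(ℚ₃)[3] = 0` and `hdual` are used at
exactly ONE point — to produce one class `y₁` with `exp*_d y₁ ≠ 0` (via `dual_{ℚ₃} = ℤ₃` on the stratum), which pins the
factor line `d_w₀` to `d` through (RES₀) in the Galois argument (GAL_loc).  The deep family of W2 (cruxes 19075 / 19076 /
19562, item 20013) lives on EVERY surjective-tower row (additive `3 ∣ c₃`, multiplicative, good anomalous … included),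
where `dual_{ℚ₃} ≠ ℤ₃` in general.  THIS FILE removes the stratum:

* §1 (generic `p`, place `v ∋ p`): `exists_expStarOmegaAt_ne_zero_of_hdual` — `hdual(d)` alone gives a class with
  `exp*_d y ≠ 0`, because the log-dual set `{a : ∀ Q, ‖a · log_ω Q‖ ≤ 1}` contains `N = [E(ℚ_p) : E⁽²⁾(ℚ_p)] ≠ 0`
  (`KimAtThreeDeepUpperExpStarUnit.index_mem_dual`: `log_ω` is BOUNDED — no reduction hypothesis);
  `exists_expStarOmegaAt_ne_zero_of_facts` — for EVERY line datum `d` (no `hdual`), from the cite fact (S5b) through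
  this seat's `hdual_of_facts_of_ringHom` (`hdual` for a rescaling `e • d`) and the scale law `exp*_{e•ω} = e⁻¹ exp*_ω`.
* §2 (`p = 3`, level `(k, r)`): `zetaBody_C3_of_level_of_ne_zero` — kim3's theorem with the three stratum binders and
  `hdual` REPLACED by the single hypothesis `∃ y, exp*_d y ≠ 0` (proof = kim3's, verbatim otherwise: w2-acc5's
  `zetaBody_C3b_of_cocycleDef` / `zetaBody_C3a_of_cocycleDef_of_galLoc`, kim3's `expStarOmega_galois`,
  `exists_conjTransport`, w2-acc4's `isGalois_adicCompletion_cyclotomicField`, w2-c2's `isScalarTower_padicAlgebra_of_continuous`);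
  the sequel `KimAtThreeDeepUpperZetaBodyC3UniformFacts` derives the `hdual`-keyed form (kim3's statement minus the
  stratum binders; hKatoV2ᵘ road, w2-c2 `KimAtThreeDeepLowerKatoParts`) and the cite-fact-keyed form (no `hdual`,
  (S5b) as a binder; hKatoExᵘ road, w2-c2 `KimAtThreeDeepLowerKatoPartsRescale` / `…KatoExactFinal`).

So once the value datum `Λ` of the deep family's Kato package is DEFINED (w2-acc5's Λ-construction, in flight for
19560), its `ZetaBody` (C3a)/(C3b) conjuncts are KERNEL on every tower row, and the displayed Kato residual of
19076 needs only Kato's printed clauses (C1)(C2)(C4)(C5) — uniformly, not only on the Kato stratum.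

References: K. Kato, Astérisque 295 (2004) §9.4 p. 188 [Kato2004Asterisque]; K. Kato, LNM 1553 (1993) II §1.2.4,
Prop. 1.2.3, Ex. 1.3.5, Thm. 1.4.1 [Kato1993LNM1553]; S. Bloch, K. Kato (1990) §3 Prop. 3.8, Ex. 3.11 [BlochKato1990];
J. H. Silverman, AEC (2009) IV.6.4, VII.6.3 [SilvermanAEC2009]; J. Neukirch, ANT (1999) II (9.6) [NeukirchANT1999];
J.-P. Serre, Local Fields VII §5 [SerreLocalFields1979].
-/

noncomputable section

-- the cell's Theorems namespace `Summit.BirchSwinnertonDyer.BirchSwinnertonDyer.…` repeats the summit name by design (D-0017)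
set_option linter.dupNamespace false

open scoped Classical NumberField TensorProduct ContRepresentation Pointwise
open Field ValuativeRel Function IsDedekindDomain NumberField
open WeierstrassCurve Literature.NumberTheory.EllipticCurves Literature.NumberTheory.GaloisRepresentations
  Literature.NumberTheory.GaloisRepresentations.DiscreteGaloisModule Literature.NumberTheory.GaloisCohomology
open Literature.NumberTheory.GaloisRepresentations.PeriodRingData Literature.NumberTheory.PAdicHodge
open Literature.NumberTheory.EllipticCurves.ModularForms Literature.NumberTheory.EllipticCurves.Rank1Residual
open Literature.NumberTheory.EllipticCurves.Kato2004 Literature.NumberTheory.EllipticCurves.Kato2004.EulerSystemValues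
open Literature.NumberTheory.AdelicBaseChange Literature.NumberTheory.Automorphic
open Summit.BirchSwinnertonDyer.Rank1Residual.GaloisImage
open Summit.BirchSwinnertonDyer.Rank1Residual.Additive.LocalLog
open Summit.BirchSwinnertonDyer.BirchSwinnertonDyer.Theorems
open Summit.BirchSwinnertonDyer.BirchSwinnertonDyer.Theorems.KimAtThreeFineKatoPerFactorDefined
open Summit.BirchSwinnertonDyer.BirchSwinnertonDyer.Theorems.KimAtThreeFineKatoLevelCompat
open Summit.BirchSwinnertonDyer.BirchSwinnertonDyer.Theorems.KimAtThreeDeepLowerExpStarOmega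
open Summit.BirchSwinnertonDyer.BirchSwinnertonDyer.Theorems.KimAtThreeDeepLowerExpStarOmegaPlace
open Summit.BirchSwinnertonDyer.BirchSwinnertonDyer.Theorems.KimAtThreeDeepLowerExpStarOmegaRes
open Summit.BirchSwinnertonDyer.BirchSwinnertonDyer.Theorems.KimAtThreeFineKatoPerFactorPlaces
open Summit.BirchSwinnertonDyer.BirchSwinnertonDyer.Theorems.KimAtThreeFineKatoExpStarGalois
open Summit.BirchSwinnertonDyer.BirchSwinnertonDyer.Theorems.KimAtThreeFineKatoValueEquivarianceBridge
open Summit.BirchSwinnertonDyer.BirchSwinnertonDyer.Theorems.KimAtThreeFineKatoValueEquivarianceLocal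
open Summit.BirchSwinnertonDyer.BirchSwinnertonDyer.Theorems.KimAtThreeFineKatoSATPointsRat

open Summit.BirchSwinnertonDyer.BirchSwinnertonDyer.Theorems.KimAtThreeFineKatoPrintClauses
open Summit.BirchSwinnertonDyer.BirchSwinnertonDyer.Theorems.KimAtThreeDeepUpperExpStarFacts
open Summit.BirchSwinnertonDyer.BirchSwinnertonDyer.Theorems.KimAtThreeDeepUpperExpStarFactsCanonical
open Summit.BirchSwinnertonDyer.BirchSwinnertonDyer.Theorems.KimAtThreeDeepUpperExpStarUnit
open Summit.BirchSwinnertonDyer.Rank1Residual.Additive (LocalLog.padicLog)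

namespace Summit.BirchSwinnertonDyer.BirchSwinnertonDyer.Theorems.KimAtThreeDeepUpperZetaBodyC3Uniform

/-! ### §1 One class with `exp*_d ≠ 0`, on every row (generic `p`, place `v ∋ p`) -/

section Generic

variable (W : WeierstrassCurve ℚ) [W.IsElliptic] (p : ℕ) [Fact p.Prime]
  (v : HeightOneSpectrum (𝓞 ℚ)) [hv : Fact (((p : ℕ) : 𝓞 ℚ) ∈ v.asIdeal)]

/-- **`hdual(d)` gives a class with `exp*_d ≠ 0`, on EVERY row**: the log-dual set contains the non-zero integer
`N = [E(ℚ_p) : E⁽²⁾(ℚ_p)]` (`index_mem_dual`: `log_ω` is bounded), so `N = exp*_d(y)` (read through `ι`) for some `y`.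
No reduction / torsion / Tamagawa hypothesis. (The structures on `ℚ_v` are the plain definitions of
`KimAtThreeDeepLowerExpStarOmegaPlace`, installed by `letI` inside the statement — no instance attribute.)
[cite: SilvermanAEC2009, IV.6.4(b) and VII.6.3] [cite: Kato1993LNM1553, Ch. II §1.2.4] -/
theorem exists_expStarOmegaAt_ne_zero_of_hdual [W.IsGloballyMinimal] :
    letI := valuativeRelPlace v
    letI := topologicalSpacePlace v
    haveI := isNonarchimedeanLocalField_place v
    haveI := charZero_place v
    letI := padicAlgebraPlace p v
    haveI := fact_not_isUnit_place p v
    haveI := isAdicComplete_place p v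
    ∀ (d : LocalNeronLineAt W p v)
      (hinj : (bdRPeriodRingData (valuation_place_lt_one p v)).CupLogInjective (logCyclotomic p)
        (localRationalTateRep W p (galRestrictPlace v)))
      (hex : ∀ z : contOneCocycles (localRationalTateRep W p (galRestrictPlace v)).toTopRep,
        (bdRPeriodRingData (valuation_place_lt_one p v)).HasDualExp (logCyclotomic p)
          (localRationalTateRep W p (galRestrictPlace v)) fun σ => z.1 σ)
      (ι : Place.Completion (Sum.inr v : Place ℚ) →+* ℚ_[p]),
      (∀ a : ℚ_[p], (∃ y, expStarOmegaPadicAt d hinj hex ι y = a) ↔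
        ∀ Q : (W.baseChange ℚ_[p]).toAffine.Point, ‖a * LocalLog.padicLog (W.baseChange ℚ_[p]) Q‖ ≤ 1) →
      ∃ y, expStarOmegaAt d y ≠ 0 := by
  letI := valuativeRelPlace v
  letI := topologicalSpacePlace v
  haveI := isNonarchimedeanLocalField_place v
  haveI := charZero_place v
  letI := padicAlgebraPlace p v
  haveI := fact_not_isUnit_place p v
  haveI := isAdicComplete_place p v
  intro d hinj hex ι hd
  obtain ⟨y, hy⟩ := (hd _).mpr (index_mem_dual (W.baseChange ℚ_[p]))
  refine ⟨y, fun h0 => ?_⟩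
  rw [expStarOmegaPadicAt_apply, h0, map_zero] at hy
  exact (Nat.cast_ne_zero.mpr (index_formalFiltration_two_ne_zero (W.baseChange ℚ_[p]))) hy.symm

/-- **For EVERY line datum `d`, some class has `exp*_d ≠ 0`** — from the cite fact (S5b) alone (through this seat's
`hdual_of_facts`: a rescaling `e • d` satisfies `hdual`, and `exp*_{e•ω} = e⁻¹ · exp*_ω`). Stratum-free.
[cite: Kato1993LNM1553, Ch. II §1.2.4 and Thm. 1.4.1 (3)–(4)] [cite: BlochKato1990, Prop. 3.8 and Example 3.11] -/
theorem exists_expStarOmegaAt_ne_zero_of_facts [W.IsGloballyMinimal] (hT : exists_smul_range_expStarCoord_iff_trace_log) :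
    letI := valuativeRelPlace v
    letI := topologicalSpacePlace v
    haveI := isNonarchimedeanLocalField_place v
    haveI := charZero_place v
    letI := padicAlgebraPlace p v
    haveI := fact_not_isUnit_place p v
    haveI := isAdicComplete_place p v
    ∀ (d : LocalNeronLineAt W p v)
      (hinj : (bdRPeriodRingData (valuation_place_lt_one p v)).CupLogInjective (logCyclotomic p)
        (localRationalTateRep W p (galRestrictPlace v)))
      (hex : ∀ z : contOneCocycles (localRationalTateRep W p (galRestrictPlace v)).toTopRep,
        (bdRPeriodRingData (valuation_place_lt_one p v)).HasDualExp (logCyclotomic p)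
          (localRationalTateRep W p (galRestrictPlace v)) fun σ => z.1 σ),
      ∃ y, expStarOmegaAt d y ≠ 0 := by
  letI := valuativeRelPlace v
  letI := topologicalSpacePlace v
  haveI := isNonarchimedeanLocalField_place v
  haveI := charZero_place v
  letI := padicAlgebraPlace p v
  haveI := fact_not_isUnit_place p v
  haveI := isAdicComplete_place p v
  intro d hinj hex
  obtain ⟨e, he, ι, hde⟩ := hdual_of_facts W p v hT d hinj hex
  obtain ⟨y, hy⟩ := exists_expStarOmegaAt_ne_zero_of_hdual W p v (d.smul e he) hinj hex ι hde
  refine ⟨y, fun h0 => hy ?_⟩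
  change expStarOmega _ _ (d.smul e he) y = 0
  rw [expStarOmega_smul _ _ d he y]
  change e⁻¹ * expStarOmegaAt d y = 0
  rw [h0, mul_zero]

end Generic

/-! ### §2 (C3a) ∧ (C3b) at one level on EVERY row (`p = 3`) -/

set_option maxHeartbeats 400000 in
/-- **`ZetaBody` (C3a) and (C3b) for a value datum defined through ONE completion at the level `(k, r)`, on EVERY
`3`-adic-tower row** — kim3's `zetaBody_C3_of_level` with the Kato-stratum binders (`Addv`, `3 ∤ c₃`, `E(ℚ₃)[3] = 0`)
and `hdual` REPLACED by the one thing they were used for: a class `y` with `exp*_d y ≠ 0`. VERBATIM the two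
own-attribution clauses of `Kato2004.ZetaBody` for `Λ_{k,r}`, from the displayed (DEF₀)/(RES₀) for `(w₀, g, d₀)`.
[cite: Kato2004Asterisque, §9.4 (p. 188)] [cite: Kato1993LNM1553, Ch. II §1.2.4 and Prop. 1.2.3]
[cite: NeukirchANT1999, Ch. II §9 Prop. (9.6)] [cite: SerreLocalFields1979, VII §5 Prop. 3] -/
theorem zetaBody_C3_of_level_of_ne_zero (W : WeierstrassCurve ℚ) [W.IsElliptic] [W.IsGloballyMinimal]
    [ContinuousSMul ℤ_[3] (W.tateModule 3)] [Module.Free ℤ_[3] (W.tateModule 3)]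
    [Module.Finite ℤ_[3] (W.tateModule 3)]
    (k : ℕ) (r : Finset (HeightOneSpectrum (𝓞 ℚ)))
    (Λkr : H1 (tateRep W 3) (cycSubgroup 3 k r) →ₗ[ℤ_[3]] ℚ_[3] ⊗[ℚ] CyclotomicField (cycLevel 3 k r) ℚ) :
    haveI : Fact (((3 : ℕ) : 𝓞 ℚ) ∈ ((Rat.HeightOneSpectrum.primesEquiv (R := 𝓞 ℚ)).symm ⟨3, Fact.out⟩).asIdeal) :=
      ⟨(natCast_mem_asIdeal_iff_eq_primesEquiv_symm _ Nat.prime_three).mpr rfl⟩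
    letI := valuativeRelPlace ((Rat.HeightOneSpectrum.primesEquiv (R := 𝓞 ℚ)).symm ⟨3, Fact.out⟩)
    letI := topologicalSpacePlace ((Rat.HeightOneSpectrum.primesEquiv (R := 𝓞 ℚ)).symm ⟨3, Fact.out⟩)
    haveI := isNonarchimedeanLocalField_place ((Rat.HeightOneSpectrum.primesEquiv (R := 𝓞 ℚ)).symm ⟨3, Fact.out⟩)
    haveI := charZero_place ((Rat.HeightOneSpectrum.primesEquiv (R := 𝓞 ℚ)).symm ⟨3, Fact.out⟩)
    letI := padicAlgebraPlace 3 ((Rat.HeightOneSpectrum.primesEquiv (R := 𝓞 ℚ)).symm ⟨3, Fact.out⟩)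
    haveI := fact_not_isUnit_place 3 ((Rat.HeightOneSpectrum.primesEquiv (R := 𝓞 ℚ)).symm ⟨3, Fact.out⟩)
    haveI := isAdicComplete_place 3 ((Rat.HeightOneSpectrum.primesEquiv (R := 𝓞 ℚ)).symm ⟨3, Fact.out⟩)
    ∀ (d : LocalNeronLineAt W 3 ((Rat.HeightOneSpectrum.primesEquiv (R := 𝓞 ℚ)).symm ⟨3, Fact.out⟩))
      (hinj : (bdRPeriodRingData (valuation_place_lt_one 3 ((Rat.HeightOneSpectrum.primesEquiv (R := 𝓞 ℚ)).symm ⟨3, Fact.out⟩))).CupLogInjective (logCyclotomic 3)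
        (localRationalTateRep W 3 (galRestrictPlace ((Rat.HeightOneSpectrum.primesEquiv (R := 𝓞 ℚ)).symm ⟨3, Fact.out⟩))))
      (hex : ∀ z : contOneCocycles (localRationalTateRep W 3 (galRestrictPlace ((Rat.HeightOneSpectrum.primesEquiv (R := 𝓞 ℚ)).symm ⟨3, Fact.out⟩))).toTopRep,
        (bdRPeriodRingData (valuation_place_lt_one 3 ((Rat.HeightOneSpectrum.primesEquiv (R := 𝓞 ℚ)).symm ⟨3, Fact.out⟩))).HasDualExp (logCyclotomic 3)
          (localRationalTateRep W 3 (galRestrictPlace ((Rat.HeightOneSpectrum.primesEquiv (R := 𝓞 ℚ)).symm ⟨3, Fact.out⟩))) fun σ => z.1 σ),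
    (∃ y, expStarOmegaAt d y ≠ 0) →
    ∀ (Ψ : ℚ_[3] ⊗[ℚ] CyclotomicField (cycLevel 3 k r) ℚ ≃ₐ[ℚ]
      (Π w : ((Rat.HeightOneSpectrum.primesEquiv (R := 𝓞 ℚ)).symm ⟨3, Fact.out⟩).Extension
        (𝓞 (CyclotomicField (cycLevel 3 k r) ℚ)), w.1.adicCompletion (CyclotomicField (cycLevel 3 k r) ℚ)))
    (hΨ : ∀ (s : ℚ_[3]) (x : CyclotomicField (cycLevel 3 k r) ℚ)
      (w : ((Rat.HeightOneSpectrum.primesEquiv (R := 𝓞 ℚ)).symm ⟨3, Fact.out⟩).Extension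
        (𝓞 (CyclotomicField (cycLevel 3 k r) ℚ))),
      Ψ (s ⊗ₜ[ℚ] x) w =
        algebraMap (CyclotomicField (cycLevel 3 k r) ℚ) (w.1.adicCompletion (CyclotomicField (cycLevel 3 k r) ℚ)) x *
        algebraMap (((Rat.HeightOneSpectrum.primesEquiv (R := 𝓞 ℚ)).symm ⟨3, Fact.out⟩).adicCompletion ℚ)
          (w.1.adicCompletion (CyclotomicField (cycLevel 3 k r) ℚ)) ((Padic.adicCompletionEquiv (𝓞 ℚ) ⟨3, Fact.out⟩) s))
    (w₀ : ((Rat.HeightOneSpectrum.primesEquiv (R := 𝓞 ℚ)).symm ⟨3, Fact.out⟩).Extension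
        (𝓞 (CyclotomicField (cycLevel 3 k r) ℚ)))
      (g : ((Rat.HeightOneSpectrum.primesEquiv (R := 𝓞 ℚ)).symm ⟨3, Fact.out⟩).Extension
        (𝓞 (CyclotomicField (cycLevel 3 k r) ℚ)) → absoluteGaloisGroup ℚ)
      (hg : ∀ w : ((Rat.HeightOneSpectrum.primesEquiv (R := 𝓞 ℚ)).symm ⟨3, Fact.out⟩).Extension
        (𝓞 (CyclotomicField (cycLevel 3 k r) ℚ)),
        sigma (cycLevel 3 k r) (modNCyclotomicCharacter ℚ (cycLevel 3 k r) (g w)) • w.1 = w₀.1),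
    letI := LocalField.charZero_adicCompletion w₀.1
    letI := LocalField.adicCompletionPadicAlgebra w₀.1 3 (three_mem_asIdeal_extension _ w₀)
    haveI : Fact (¬ IsUnit ((3 : ℕ) : integerC (w₀.1.adicCompletion (CyclotomicField (cycLevel 3 k r) ℚ)))) :=
      ⟨not_isUnit_natCast_integerC (LocalField.valuation_adicCompletion_natCast_lt_one w₀.1 3 (three_mem_asIdeal_extension _ w₀))⟩
    haveI := isAdicComplete_integerC_natCast (LocalField.valuation_adicCompletion_natCast_lt_one w₀.1 3 (three_mem_asIdeal_extension _ w₀))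
    ∀ (dw : LocalNeronLine W (LocalField.valuation_adicCompletion_natCast_lt_one w₀.1 3 (three_mem_asIdeal_extension _ w₀))
      ((galRestrictPlace ((Rat.HeightOneSpectrum.primesEquiv (R := 𝓞 ℚ)).symm ⟨3, Fact.out⟩)).comp
        (absGaloisRestrict (((Rat.HeightOneSpectrum.primesEquiv (R := 𝓞 ℚ)).symm ⟨3, Fact.out⟩).adicCompletion ℚ) (w₀.1.adicCompletion (CyclotomicField (cycLevel 3 k r) ℚ)))))
      (hinjw : (bdRPeriodRingData (LocalField.valuation_adicCompletion_natCast_lt_one w₀.1 3 (three_mem_asIdeal_extension _ w₀))).CupLogInjective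
      (logCyclotomic 3) (localRationalTateRep W 3 ((galRestrictPlace ((Rat.HeightOneSpectrum.primesEquiv (R := 𝓞 ℚ)).symm ⟨3, Fact.out⟩)).comp
        (absGaloisRestrict (((Rat.HeightOneSpectrum.primesEquiv (R := 𝓞 ℚ)).symm ⟨3, Fact.out⟩).adicCompletion ℚ) (w₀.1.adicCompletion (CyclotomicField (cycLevel 3 k r) ℚ))))))
      (hexw : ∀ z : contOneCocycles (localRationalTateRep W 3 ((galRestrictPlace ((Rat.HeightOneSpectrum.primesEquiv (R := 𝓞 ℚ)).symm ⟨3, Fact.out⟩)).comp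
        (absGaloisRestrict (((Rat.HeightOneSpectrum.primesEquiv (R := 𝓞 ℚ)).symm ⟨3, Fact.out⟩).adicCompletion ℚ) (w₀.1.adicCompletion (CyclotomicField (cycLevel 3 k r) ℚ))))).toTopRep,
      (bdRPeriodRingData (LocalField.valuation_adicCompletion_natCast_lt_one w₀.1 3 (three_mem_asIdeal_extension _ w₀))).HasDualExp
        (logCyclotomic 3) (localRationalTateRep W 3 ((galRestrictPlace ((Rat.HeightOneSpectrum.primesEquiv (R := 𝓞 ℚ)).symm ⟨3, Fact.out⟩)).comp
        (absGaloisRestrict (((Rat.HeightOneSpectrum.primesEquiv (R := 𝓞 ℚ)).symm ⟨3, Fact.out⟩).adicCompletion ℚ) (w₀.1.adicCompletion (CyclotomicField (cycLevel 3 k r) ℚ))))) fun σ => z.1 σ),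
    (∀ (h : (tateLocalRep W 3 (Sum.inr ((Rat.HeightOneSpectrum.primesEquiv (R := 𝓞 ℚ)).symm ⟨3, Fact.out⟩))).cohomology 1),
      (expStarOmegaHom (LocalField.valuation_adicCompletion_natCast_lt_one w₀.1 3 (three_mem_asIdeal_extension _ w₀))
        ((galRestrictPlace ((Rat.HeightOneSpectrum.primesEquiv (R := 𝓞 ℚ)).symm ⟨3, Fact.out⟩)).comp
        (absGaloisRestrict (((Rat.HeightOneSpectrum.primesEquiv (R := 𝓞 ℚ)).symm ⟨3, Fact.out⟩).adicCompletion ℚ) (w₀.1.adicCompletion (CyclotomicField (cycLevel 3 k r) ℚ)))) dw hinjw hexw)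
        (ContinuousRep.cohomologyRes (tateLocalRep W 3 (Sum.inr ((Rat.HeightOneSpectrum.primesEquiv (R := 𝓞 ℚ)).symm ⟨3, Fact.out⟩)))
          (absGaloisRestrict (((Rat.HeightOneSpectrum.primesEquiv (R := 𝓞 ℚ)).symm ⟨3, Fact.out⟩).adicCompletion ℚ) (w₀.1.adicCompletion (CyclotomicField (cycLevel 3 k r) ℚ))) 1 h) =
      algebraMap (((Rat.HeightOneSpectrum.primesEquiv (R := 𝓞 ℚ)).symm ⟨3, Fact.out⟩).adicCompletion ℚ) (w₀.1.adicCompletion (CyclotomicField (cycLevel 3 k r) ℚ)) (expStarOmegaAt d h)) →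
    (∀ (w : ((Rat.HeightOneSpectrum.primesEquiv (R := 𝓞 ℚ)).symm ⟨3, Fact.out⟩).Extension
        (𝓞 (CyclotomicField (cycLevel 3 k r) ℚ)))
      (y : H1 (tateRep W 3) (cycSubgroup 3 k r))
      (φ'' : contOneCocycles (subgroupRep (tateRep W 3).toTopRep (cycSubgroup 3 k r)))
      (ψT : contOneCocycles ((tateLocalRep W 3 (Sum.inr ((Rat.HeightOneSpectrum.primesEquiv (R := 𝓞 ℚ)).symm ⟨3, Fact.out⟩))).restrict
        (absGaloisRestrict (((Rat.HeightOneSpectrum.primesEquiv (R := 𝓞 ℚ)).symm ⟨3, Fact.out⟩).adicCompletion ℚ) (w₀.1.adicCompletion (CyclotomicField (cycLevel 3 k r) ℚ)))).toTopRep),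
      oneCocycleClass _ φ'' = conjMap (tateRep W 3).toTopRep (cycSubgroup 3 k r) (g w) 1 y →
      (∀ σ, ψT.1 σ = φ''.1 ⟨absGaloisRestrictTower ℚ (((Rat.HeightOneSpectrum.primesEquiv (R := 𝓞 ℚ)).symm ⟨3, Fact.out⟩).adicCompletion ℚ) (w₀.1.adicCompletion (CyclotomicField (cycLevel 3 k r) ℚ)) σ,
        absGaloisRestrictTower_adicCompletion_mem_cycSubgroup_level k r w₀ σ⟩) →
      Ψ (Λkr y) w = galAdicCompletionMap
        (sigma (cycLevel 3 k r) (modNCyclotomicCharacter ℚ (cycLevel 3 k r) (g w)))⁻¹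
        (inv_smul_eq_of_smul_eq (hg w))
        ((expStarOmegaHom (LocalField.valuation_adicCompletion_natCast_lt_one w₀.1 3 (three_mem_asIdeal_extension _ w₀))
        ((galRestrictPlace ((Rat.HeightOneSpectrum.primesEquiv (R := 𝓞 ℚ)).symm ⟨3, Fact.out⟩)).comp
        (absGaloisRestrict (((Rat.HeightOneSpectrum.primesEquiv (R := 𝓞 ℚ)).symm ⟨3, Fact.out⟩).adicCompletion ℚ) (w₀.1.adicCompletion (CyclotomicField (cycLevel 3 k r) ℚ)))) dw hinjw hexw) (oneCocycleClass _ ψT))) →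
    (∀ (σ : absoluteGaloisGroup ℚ) (y : H1 (tateRep W 3) (cycSubgroup 3 k r)),
      Λkr (conjMap (tateRep W 3).toTopRep (cycSubgroup 3 k r) σ 1 y) =
        Algebra.TensorProduct.map (AlgHom.id ℚ ℚ_[3])
          (sigma (cycLevel 3 k r) (modNCyclotomicCharacter ℚ (cycLevel 3 k r) σ) :
            CyclotomicField (cycLevel 3 k r) ℚ →ₐ[ℚ] CyclotomicField (cycLevel 3 k r) ℚ) (Λkr y)) ∧
    (∀ (y : H1 (tateRep W 3) (cycSubgroup 3 k r)),
      (∀ v : HeightOneSpectrum (𝓞 ℚ), ((Rat.HeightOneSpectrum.primesEquiv v : Nat.Primes) : ℕ) = 3 →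
        ∀ 𝔓 ∈ v.primesAbove, resLe (tateRep W 3).toTopRep
          (inf_le_left : cycSubgroup 3 k r ⊓ MulAction.stabilizer (absoluteGaloisGroup ℚ) 𝔓 ≤ cycSubgroup 3 k r) 1 y = 0) →
      Λkr y = 0) := by
  haveI : Fact (((3 : ℕ) : 𝓞 ℚ) ∈ ((Rat.HeightOneSpectrum.primesEquiv (R := 𝓞 ℚ)).symm ⟨3, Fact.out⟩).asIdeal) :=
    ⟨(natCast_mem_asIdeal_iff_eq_primesEquiv_symm _ Nat.prime_three).mpr rfl⟩
  letI := valuativeRelPlace ((Rat.HeightOneSpectrum.primesEquiv (R := 𝓞 ℚ)).symm ⟨3, Fact.out⟩)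
  letI := topologicalSpacePlace ((Rat.HeightOneSpectrum.primesEquiv (R := 𝓞 ℚ)).symm ⟨3, Fact.out⟩)
  haveI := isNonarchimedeanLocalField_place ((Rat.HeightOneSpectrum.primesEquiv (R := 𝓞 ℚ)).symm ⟨3, Fact.out⟩)
  haveI := charZero_place ((Rat.HeightOneSpectrum.primesEquiv (R := 𝓞 ℚ)).symm ⟨3, Fact.out⟩)
  letI := padicAlgebraPlace 3 ((Rat.HeightOneSpectrum.primesEquiv (R := 𝓞 ℚ)).symm ⟨3, Fact.out⟩)
  haveI := fact_not_isUnit_place 3 ((Rat.HeightOneSpectrum.primesEquiv (R := 𝓞 ℚ)).symm ⟨3, Fact.out⟩)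
  haveI := isAdicComplete_place 3 ((Rat.HeightOneSpectrum.primesEquiv (R := 𝓞 ℚ)).symm ⟨3, Fact.out⟩)
  intro d hinj hex hy₁ Ψ hΨ w₀ g hg
  letI := LocalField.charZero_adicCompletion w₀.1
  letI := LocalField.adicCompletionPadicAlgebra w₀.1 3 (three_mem_asIdeal_extension _ w₀)
  haveI : Fact (¬ IsUnit ((3 : ℕ) : integerC (w₀.1.adicCompletion (CyclotomicField (cycLevel 3 k r) ℚ)))) :=
    ⟨not_isUnit_natCast_integerC (LocalField.valuation_adicCompletion_natCast_lt_one w₀.1 3 (three_mem_asIdeal_extension _ w₀))⟩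
  haveI := isAdicComplete_integerC_natCast (LocalField.valuation_adicCompletion_natCast_lt_one w₀.1 3 (three_mem_asIdeal_extension _ w₀))
  intro dw hinjw hexw hresw hdefw
  -- `Place.Completion (inr v₀)` IS `ℚ_{v₀}`: read the packet's algebra structure on it (acc5's currency)
  letI instEF : Algebra (NumberField.Place.Completion (K := ℚ) (Sum.inr ((Rat.HeightOneSpectrum.primesEquiv (R := 𝓞 ℚ)).symm ⟨3, Fact.out⟩)))
      (w₀.1.adicCompletion (CyclotomicField (cycLevel 3 k r) ℚ)) :=
    inferInstanceAs (Algebra (((Rat.HeightOneSpectrum.primesEquiv (R := 𝓞 ℚ)).symm ⟨3, Fact.out⟩).adicCompletion ℚ) (w₀.1.adicCompletion (CyclotomicField (cycLevel 3 k r) ℚ)))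
  refine ⟨?_, fun y hy => ?_⟩
  swap
  · -- (C3b) from (DEF₀) alone (w2-acc5's Bridge)
    exact zetaBody_C3b_of_cocycleDef W 3 k r Λkr Ψ w₀
      (absGaloisRestrictTower_adicCompletion_mem_cycSubgroup_level k r w₀)
      (expStarOmegaHom (LocalField.valuation_adicCompletion_natCast_lt_one w₀.1 3 (three_mem_asIdeal_extension _ w₀))
        ((galRestrictPlace ((Rat.HeightOneSpectrum.primesEquiv (R := 𝓞 ℚ)).symm ⟨3, Fact.out⟩)).comp
          (absGaloisRestrict (((Rat.HeightOneSpectrum.primesEquiv (R := 𝓞 ℚ)).symm ⟨3, Fact.out⟩).adicCompletion ℚ)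
            (w₀.1.adicCompletion (CyclotomicField (cycLevel 3 k r) ℚ)))) dw hinjw hexw)
      (fun w => (galAdicCompletionMap (sigma (cycLevel 3 k r) (modNCyclotomicCharacter ℚ (cycLevel 3 k r) (g w)))⁻¹
        (inv_smul_eq_of_smul_eq (hg w))).toAddMonoidHom) g
      (fun w y φ'' ψT hφ'' hψT => hdefw w y φ'' ψT hφ'' hψT) y hy
  -- (C3a) from (DEF₀) + (GAL_loc)
  -- Galois bookkeeping: `L_{w₀}/ℚ_{v₀}` is Galois, so conjugations by `δ' ∈ Γ_{ℚ_{v₀}}` transport to `Γ_{L_{w₀}}`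
  haveI hGal : IsGalois (NumberField.Place.Completion (K := ℚ) (Sum.inr ((Rat.HeightOneSpectrum.primesEquiv (R := 𝓞 ℚ)).symm ⟨3, Fact.out⟩)))
      (w₀.1.adicCompletion (CyclotomicField (cycLevel 3 k r) ℚ)) :=
    isGalois_adicCompletion_cyclotomicField (cycLevel 3 k r) ((Rat.HeightOneSpectrum.primesEquiv (R := 𝓞 ℚ)).symm ⟨3, Fact.out⟩) w₀
  have hconj := fun δ' : absoluteGaloisGroup (NumberField.Place.Completion (K := ℚ) (Sum.inr ((Rat.HeightOneSpectrum.primesEquiv (R := 𝓞 ℚ)).symm ⟨3, Fact.out⟩))) =>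
    exists_conjTransport (K := NumberField.Place.Completion (K := ℚ) (Sum.inr ((Rat.HeightOneSpectrum.primesEquiv (R := 𝓞 ℚ)).symm ⟨3, Fact.out⟩)))
      (L := w₀.1.adicCompletion (CyclotomicField (cycLevel 3 k r) ℚ)) δ'
  choose s hs using hconj
  -- the continuous inclusion `ℚ_{v₀} → L_{w₀}` and the scalar tower of the canonical `ℚ₃`-structures
  have hcont : Continuous (algebraMap (NumberField.Place.Completion (K := ℚ) (Sum.inr ((Rat.HeightOneSpectrum.primesEquiv (R := 𝓞 ℚ)).symm ⟨3, Fact.out⟩)))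
      (w₀.1.adicCompletion (CyclotomicField (cycLevel 3 k r) ℚ))) :=
    continuous_algebraMap (((Rat.HeightOneSpectrum.primesEquiv (R := 𝓞 ℚ)).symm ⟨3, Fact.out⟩).adicCompletion ℚ)
      (w₀.1.adicCompletion (CyclotomicField (cycLevel 3 k r) ℚ))
  haveI hSTp : IsScalarTower ℚ_[3] (NumberField.Place.Completion (K := ℚ) (Sum.inr ((Rat.HeightOneSpectrum.primesEquiv (R := 𝓞 ℚ)).symm ⟨3, Fact.out⟩)))
      (w₀.1.adicCompletion (CyclotomicField (cycLevel 3 k r) ℚ)) :=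
    isScalarTower_padicAlgebra_of_continuous 3 hcont
      (valuation_place_lt_one 3 ((Rat.HeightOneSpectrum.primesEquiv (R := 𝓞 ℚ)).symm ⟨3, Fact.out⟩))
      (LocalField.valuation_adicCompletion_natCast_lt_one w₀.1 3 (three_mem_asIdeal_extension _ w₀))
  -- one class with `exp*_d ≠ 0`: the HYPOTHESIS (stratum-free; see the `_of_hdual` / `_of_facts` corollaries)
  obtain ⟨y₁, hy₁⟩ := hy₁
  have hh₀ : expStarOmega (valuation_place_lt_one 3 ((Rat.HeightOneSpectrum.primesEquiv (R := 𝓞 ℚ)).symm ⟨3, Fact.out⟩))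
      (galRestrictPlace ((Rat.HeightOneSpectrum.primesEquiv (R := 𝓞 ℚ)).symm ⟨3, Fact.out⟩)) d y₁ ≠ 0 := hy₁
  refine zetaBody_C3a_of_cocycleDef_of_galLoc W 3 k r w₀
    (absGaloisRestrictTower_adicCompletion_mem_cycSubgroup_level k r w₀)
    (expStarOmegaHom (LocalField.valuation_adicCompletion_natCast_lt_one w₀.1 3 (three_mem_asIdeal_extension _ w₀))
        ((galRestrictPlace ((Rat.HeightOneSpectrum.primesEquiv (R := 𝓞 ℚ)).symm ⟨3, Fact.out⟩)).comp
          (absGaloisRestrict (((Rat.HeightOneSpectrum.primesEquiv (R := 𝓞 ℚ)).symm ⟨3, Fact.out⟩).adicCompletion ℚ)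
            (w₀.1.adicCompletion (CyclotomicField (cycLevel 3 k r) ℚ)))) dw hinjw hexw)
    Λkr Ψ hΨ g hg (fun w y φ'' ψT hφ'' hψT => hdefw w y φ'' ψT hφ'' hψT) (fun δ' τ => s δ' τ) hs ?_
  intro δ' hδ c c' hc'
  exact expStarOmega_galois
    (K := NumberField.Place.Completion (K := ℚ) (Sum.inr ((Rat.HeightOneSpectrum.primesEquiv (R := 𝓞 ℚ)).symm ⟨3, Fact.out⟩)))
    (L := w₀.1.adicCompletion (CyclotomicField (cycLevel 3 k r) ℚ)) (p := 3)
    (valuation_place_lt_one 3 ((Rat.HeightOneSpectrum.primesEquiv (R := 𝓞 ℚ)).symm ⟨3, Fact.out⟩))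
    (LocalField.valuation_adicCompletion_natCast_lt_one w₀.1 3 (three_mem_asIdeal_extension _ w₀)) W
    (galRestrictPlace ((Rat.HeightOneSpectrum.primesEquiv (R := 𝓞 ℚ)).symm ⟨3, Fact.out⟩)) hcont δ' (s δ') (hs δ')
    (galAdicCompletionMap _ hδ)
    (fun x => galAdicCompletionMap_algebraMap_adicCompletion _ _ w₀ w₀ hδ x)
    (fun y x hyx => absClosureEmbedding_smul_eq_galAdicCompletionMap 3 k r w₀ δ' hδ y x hyx)
    d dw hinjw hexw (fun y => hresw y) y₁ hh₀ c c' (fun τ => hc' τ)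

end Summit.BirchSwinnertonDyer.BirchSwinnertonDyer.Theorems.KimAtThreeDeepUpperZetaBodyC3Uniform

end
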